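import Summits.HubbardSuperconductivity.HubbardSuperconductivity.Theses.AnisotropyChord
import Summits.HubbardSuperconductivity.HubbardSuperconductivity.Theorems.AnisotropyChordDoobJohnsonChordPlan

/-!
# Route `AnisotropyChord`, crux `ChordXY` (stmt-HubbardSuperconductivity-8146), line `doob-johnson-chord`:
# the DIAGONAL of PLAN A — ratio antitonicity of `Λ_M(u)/(1+u)` and the log-slope bound give `ChordXY`
# DIRECTLY (support lemmas; lead-8146-chordxy g1)

Vocabulary of `…Theorems.AnisotropyChordDoobJohnsonChordDefs` (`Config`, `Hxxz`, `Otot`, `lam`, `IsGS`,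
`ofReal`, `field`).  `Λ_M(u)` denotes `lam M (ofReal M ψ_u)` for the (unique) real non-negative normalised
`S^z_tot = 0` sector ground state `ψ_u` of `H_M(u)` (`sectorPerron_condensate`).

The stub-critic's PLAN A for the hardest stub `stub_frozenFieldChord` (STUB-PLAN-stub_frozenFieldChord.md,
2026-08-31) is: H1 Doob–Hellmann–Feynman, H2 the DIAGONAL LOG-SLOPE BOUND `(1+u)·Λ_M'(u) ≤ Λ_M(u)` on
`(-1,0)`, H3 "LFFRA from the log-slope bound by continuity/compactness".  This file records, sorry-free,
what the diagonal log-slope bound actually buys: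

* `lamRatio_le_of_logSlope` — for ONE `M` and ANY family `Ψ : ℝ → (Config M → ℝ)` of real non-negative
  normalised sector ground states: if `u ↦ Λ(Ψ u)` has a derivative `L' u` at every `u ∈ (-1,0)` with
  `(1+u)·L' u ≤ Λ(Ψ u)`, and is continuous at `0` from the left, then for all `-1 < s ≤ t ≤ 0` and ALL
  real non-negative sector ground states `ψs, ψt` at `s, t`:  `(1+s)·Λ(ψt) ≤ (1+t)·Λ(ψs)`
  (`u ↦ Λ_M(u)/(1+u)` is antitone on `(-1,0]`; mean value theorem, `antitoneOn_of_deriv_nonpos`);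
* `lamRatioAntitone_of_local` — the derivative-free twin: a STEP-LOCAL ratio inequality (steps
  `t - s ≤ δ(M,a)` on `[a,0]`, every `a > -1`) chains to the global one;
* `chordXY_of_lamRatioAntitone` — the global ratio inequality for every even `M ≥ 4` IS the route item
  `ChordXY` (take `(s,t) = (Δ,0)`; `Δ = -1` reads `0 ≤ Λ`; phase uniqueness of sector ground states);
* `chordXY_of_logSlope` — hence H2 alone (with H1-type differentiability) closes the CRUX, by name.

CONSEQUENCE FOR THE PLAN (lead's finding, see the session RESULT): the diagonal log-slope bound does NOT
give the frozen-field statements LFFRA / `stub_frozenFieldChord` (those freeze the field at `Δ` while the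
base point `s` runs over `[Δ,0]`; the diagonal supplies only the germ `s = Δ`), but it gives `ChordXY`
itself — the frozen-field detour is unnecessary for PLAN A, and H2 is exactly the open content.
All hypotheses are EXPLICIT (no `def`); folklore calculus + bookkeeping.  HONEST: nothing here proves the
log-slope bound, `stub_frozenFieldChord` or `ChordXY`; superconductivity in the Hubbard model is not
advanced.
-/

set_option linter.dupNamespace false

noncomputable section

namespace Summit.HubbardSuperconductivity.HubbardSuperconductivity.Theorems.AnisotropyChord.DoobJohnsonChord

open Matrix Finset Set
open Literature.MathematicalPhysics.QuantumLattice Literature.Probability.LatticeModels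

/-! ### Phase uniqueness: `Λ` takes one value on the sector ground states at `u` -/

/-- `Λ` takes the same value on all normalised sector ground states at a given anisotropy (they are unit
multiples of the Perron state; `lam_smul`). [folklore] -/
theorem lam_eq_of_isGS (M : ℕ) [NeZero M] (hE : Even M) (u : ℝ) (φ χ : Config M → ℂ)
    (hφ : IsGS M u φ) (hχ : IsGS M u χ) : lam M φ = lam M χ := by
  obtain ⟨ψr, -, -, -, huniq⟩ := sectorPerron_condensate M hE u
  obtain ⟨a, ha, rfl⟩ := huniq φ hφ
  obtain ⟨b, hb, rfl⟩ := huniq χ hχ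
  rw [lam_smul, lam_smul, ha, hb]

/-! ### The log-slope bound along a Perron family gives the ratio inequality -/

/-- **The diagonal log-slope bound integrates to ratio antitonicity.**  Fix `M` (even) and a family
`Ψ u` of real non-negative normalised sector ground states of `H_M(u)`.  If `u ↦ Λ(Ψ u)` has derivative
`L' u` with `(1+u)·L' u ≤ Λ(Ψ u)` at every `u ∈ (-1,0)` and is continuous at `0` within `(-∞,0]`, then
`(1+s)·Λ(ψt) ≤ (1+t)·Λ(ψs)` for all `-1 < s ≤ t ≤ 0` and all real non-negative normalised sector ground
states `ψs`, `ψt` at `s`, `t` (i.e. `u ↦ Λ_M(u)/(1+u)` is antitone on `(-1,0]`).  Mean value theorem on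
`Λ/(1+u)`. [folklore] -/
theorem lamRatio_le_of_logSlope (M : ℕ) [NeZero M] (hE : Even M) (Ψ : ℝ → Config M → ℝ)
    (hΨ : ∀ u, IsGS M u (ofReal M (Ψ u))) (L' : ℝ → ℝ)
    (hd : ∀ u ∈ Set.Ioo (-1:ℝ) 0, HasDerivAt (fun v => lam M (ofReal M (Ψ v))) (L' u) u)
    (hls : ∀ u ∈ Set.Ioo (-1:ℝ) 0, (1 + u) * L' u ≤ lam M (ofReal M (Ψ u)))
    (hc0 : ContinuousWithinAt (fun v => lam M (ofReal M (Ψ v))) (Set.Iic 0) 0) :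
    ∀ (s t : ℝ), -1 < s → s ≤ t → t ≤ 0 → ∀ (ψs ψt : Config M → ℝ),
      IsGS M s (ofReal M ψs) → IsGS M t (ofReal M ψt) →
        (1 + s) * lam M (ofReal M ψt) ≤ (1 + t) * lam M (ofReal M ψs) := by
  set L : ℝ → ℝ := fun v => lam M (ofReal M (Ψ v)) with hL
  set g : ℝ → ℝ := fun v => L v / (1 + v) with hg
  -- `g` is antitone on `(-1, 0]`
  have hint : interior (Set.Ioc (-1:ℝ) 0) = Set.Ioo (-1:ℝ) 0 := interior_Ioc
  have hg_der : ∀ u ∈ Set.Ioo (-1:ℝ) 0,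
      HasDerivAt g ((L' u * (1 + u) - L u * 1) / (1 + u) ^ 2) u := by
    intro u hu
    have h1 : (0:ℝ) < 1 + u := by linarith [hu.1]
    have hden : HasDerivAt (fun v : ℝ => 1 + v) 1 u := by
      simpa using (hasDerivAt_id u).const_add 1
    exact (hd u hu).div hden h1.ne'
  have hg_cont : ContinuousOn g (Set.Ioc (-1:ℝ) 0) := by
    intro u hu
    rcases eq_or_lt_of_le hu.2 with h0 | h0
    · -- `u = 0`: continuity from the left
      rw [h0]
      have hden : ContinuousWithinAt (fun v : ℝ => 1 + v) (Set.Ioc (-1:ℝ) 0) 0 :=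
        (continuous_const.add continuous_id).continuousWithinAt
      have hnum : ContinuousWithinAt L (Set.Ioc (-1:ℝ) 0) 0 :=
        hc0.mono fun v hv => hv.2
      have h := hnum.div hden (by norm_num)
      exact h
    · -- interior point: differentiable there
      have hu' : u ∈ Set.Ioo (-1:ℝ) 0 := ⟨hu.1, h0⟩
      exact (hg_der u hu').continuousAt.continuousWithinAt
  have hg_diff : DifferentiableOn ℝ g (interior (Set.Ioc (-1:ℝ) 0)) := by
    rw [hint]
    intro u hu
    exact (hg_der u hu).differentiableAt.differentiableWithinAt
  have hg_nonpos : ∀ u ∈ interior (Set.Ioc (-1:ℝ) 0), deriv g u ≤ 0 := by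
    rw [hint]
    intro u hu
    rw [(hg_der u hu).deriv]
    have h1 : (0:ℝ) < 1 + u := by linarith [hu.1]
    have hnum : L' u * (1 + u) - L u * 1 ≤ 0 := by
      have := hls u hu
      simp only [hL] at this ⊢
      linarith
    exact div_nonpos_of_nonpos_of_nonneg hnum (sq_nonneg _)
  have hanti : AntitoneOn g (Set.Ioc (-1:ℝ) 0) :=
    antitoneOn_of_deriv_nonpos (convex_Ioc _ _) hg_cont hg_diff hg_nonpos
  -- read off the ratio inequality
  intro s t hs hst ht ψs ψt hGSs hGSt
  have hs1 : (0:ℝ) < 1 + s := by linarith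
  have ht1 : (0:ℝ) < 1 + t := by linarith
  have hgs := hanti ⟨hs, hst.trans ht⟩ ⟨by linarith, ht⟩ hst
  -- `g t ≤ g s`
  simp only [hg] at hgs
  rw [div_le_div_iff₀ ht1 hs1] at hgs
  have hLs : lam M (ofReal M ψs) = L s := lam_eq_of_isGS M hE s _ _ hGSs (hΨ s)
  have hLt : lam M (ofReal M ψt) = L t := lam_eq_of_isGS M hE t _ _ hGSt (hΨ t)
  rw [hLs, hLt]
  linarith

/-! ### The step-local ratio inequality chains to the global one -/

/-- **Step-local ⇒ global.**  If for every `a > -1` there is `δ > 0` such that the ratio inequality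
`(1+s)·Λ(ψt) ≤ (1+t)·Λ(ψs)` holds for all `a ≤ s ≤ t ≤ 0` with `t - s ≤ δ` (real non-negative
normalised sector ground states `ψs, ψt`), then it holds for all `-1 < s ≤ t ≤ 0` (chain along an
equally spaced partition of `[s,t]` with Perron states at the nodes; all factors `1 + u > 0`).
[bookkeeping] -/
theorem lamRatioAntitone_of_local (M : ℕ) [NeZero M] (hE : Even M)
    (hL : ∀ a : ℝ, -1 < a → ∃ δ : ℝ, 0 < δ ∧ ∀ (s t : ℝ), a ≤ s → s ≤ t → t ≤ 0 → t - s ≤ δ →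
      ∀ (ψs ψt : Config M → ℝ), IsGS M s (ofReal M ψs) → (∀ σ, 0 ≤ ψs σ) →
        IsGS M t (ofReal M ψt) → (∀ σ, 0 ≤ ψt σ) →
          (1 + s) * lam M (ofReal M ψt) ≤ (1 + t) * lam M (ofReal M ψs)) :
    ∀ (s t : ℝ), -1 < s → s ≤ t → t ≤ 0 → ∀ (ψs ψt : Config M → ℝ),
      IsGS M s (ofReal M ψs) → (∀ σ, 0 ≤ ψs σ) → IsGS M t (ofReal M ψt) → (∀ σ, 0 ≤ ψt σ) →
        (1 + s) * lam M (ofReal M ψt) ≤ (1 + t) * lam M (ofReal M ψs) := by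
  intro s t hs hst ht ψs ψt hGSs hnns hGSt hnnt
  obtain ⟨δ, hδ, hstep⟩ := hL s hs
  choose pf hpf_nn hpf_GS _hpf_supp hpf_uniq using fun u : ℝ => sectorPerron_condensate M hE u
  -- partition of `[s, t]` into `n` steps of length `h ≤ δ`
  set n : ℕ := ⌈(t - s) / δ⌉₊ + 1 with hn
  have hn0 : 0 < (n : ℝ) := by positivity
  set h : ℝ := (t - s) / n with hh
  have hh0 : 0 ≤ h := div_nonneg (by linarith) hn0.le
  have hnh : s + (n : ℝ) * h = t := by
    rw [hh, mul_div_cancel₀ _ hn0.ne']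
    ring
  have hhδ : h ≤ δ := by
    have h1 : (t - s) / δ ≤ (n : ℝ) := by
      have hc := Nat.le_ceil ((t - s) / δ)
      rw [hn]
      push_cast
      linarith
    rw [hh, div_le_iff₀ hn0]
    have h2 := (div_le_iff₀ hδ).1 h1
    calc t - s ≤ (n : ℝ) * δ := h2
      _ = δ * n := mul_comm _ _
  -- the chained inequality at the Perron nodes `u_k = s + k h`
  have hchain : ∀ k : ℕ, k ≤ n →
      (1 + s) * lam M (ofReal M (pf (s + k * h))) ≤ (1 + (s + k * h)) * lam M (ofReal M (pf s)) := by
    intro k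
    induction k with
    | zero =>
      intro _
      simp
    | succ k ih =>
      intro hk
      have IH := ih (Nat.le_of_succ_le hk)
      have hcast : ((k + 1 : ℕ) : ℝ) = (k : ℝ) + 1 := by push_cast; ring
      rw [hcast]
      have hk1 : (k : ℝ) + 1 ≤ n := by exact_mod_cast hk
      have hks : s ≤ s + k * h := by nlinarith
      have hkst : s + k * h ≤ s + (k + 1) * h := by nlinarith
      have hkt : s + (k + 1) * h ≤ 0 := by nlinarith
      have hkts : s + (k + 1) * h - (s + k * h) ≤ δ := by nlinarith
      have step := hstep (s + k * h) (s + (k + 1) * h) hks hkst hkt hkts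
        (pf (s + k * h)) (pf (s + (k + 1) * h)) (hpf_GS _) (hpf_nn _) (hpf_GS _) (hpf_nn _)
      have h1s : 0 < 1 + (s + k * h) := by linarith
      have h1t : 0 ≤ 1 + (s + (k + 1) * h) := by linarith
      have h1s0 : 0 < 1 + s := by linarith
      refine le_of_mul_le_mul_left ?_ h1s
      calc (1 + (s + k * h)) * ((1 + s) * lam M (ofReal M (pf (s + (k + 1) * h))))
          = (1 + s) * ((1 + (s + k * h)) * lam M (ofReal M (pf (s + (k + 1) * h)))) := by ring
        _ ≤ (1 + s) * ((1 + (s + (k + 1) * h)) * lam M (ofReal M (pf (s + k * h)))) :=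
            mul_le_mul_of_nonneg_left step h1s0.le
        _ = (1 + (s + (k + 1) * h)) * ((1 + s) * lam M (ofReal M (pf (s + k * h)))) := by ring
        _ ≤ (1 + (s + (k + 1) * h)) * ((1 + (s + k * h)) * lam M (ofReal M (pf s))) :=
            mul_le_mul_of_nonneg_left IH h1t
        _ = (1 + (s + k * h)) * ((1 + (s + (k + 1) * h)) * lam M (ofReal M (pf s))) := by ring
  have hfin := hchain n le_rfl
  rw [hnh] at hfin
  -- identify the two end values with the given ground states
  rw [lam_eq_of_isGS M hE t _ _ hGSt (hpf_GS t), lam_eq_of_isGS M hE s _ _ hGSs (hpf_GS s)]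
  exact hfin

/-! ### The ratio inequality IS the crux `ChordXY` (by name) -/

/-- **Ratio antitonicity of `Λ_M(u)/(1+u)` on `(-1,0]` for every even `M ≥ 4` gives the route item
`ChordXY`** (stmt-HubbardSuperconductivity-8146) BY NAME: take `(s,t) = (Δ,0)`; the endpoint `Δ = -1`
reads `0 ≤ Λ(ψ)` (`lam_nonneg`); arbitrary normalised sector ground states are unit multiples of the
Perron states (`lam_eq_of_isGS`).  The hypothesis is explicit — this is a REDUCTION, weaker than the
registered concavity line and than the frozen-field chord, not a proof of `ChordXY`. [bookkeeping] -/
theorem chordXY_of_lamRatioAntitone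
    (hR : ∀ (M : ℕ) [NeZero M], Even M → 4 ≤ M → ∀ (s t : ℝ), -1 < s → s ≤ t → t ≤ 0 →
      ∀ (ψs ψt : Config M → ℝ), IsGS M s (ofReal M ψs) → (∀ σ, 0 ≤ ψs σ) →
        IsGS M t (ofReal M ψt) → (∀ σ, 0 ≤ ψt σ) →
          (1 + s) * lam M (ofReal M ψt) ≤ (1 + t) * lam M (ofReal M ψs)) :
    Summit.HubbardSuperconductivity.HubbardSuperconductivity.Theses.AnisotropyChord.ChordXY := by
  intro M _ hE h4 Δ hΔ ψ₀ ψ hmem₀ hn₀ heig₀ hmem hn heig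
  obtain ⟨ψr0, hnn0, hGS0, -, -⟩ := sectorPerron_condensate M hE 0
  obtain ⟨ψrΔ, hnnΔ, hGSΔ, -, -⟩ := sectorPerron_condensate M hE Δ
  have h0 : lam M ψ₀ = lam M (ofReal M ψr0) := lam_eq_of_isGS M hE 0 _ _ ⟨hmem₀, hn₀, heig₀⟩ hGS0
  have hΔ' : lam M ψ = lam M (ofReal M ψrΔ) := lam_eq_of_isGS M hE Δ _ _ ⟨hmem, hn, heig⟩ hGSΔ
  change (1 + Δ) * lam M ψ₀ ≤ lam M ψ
  rw [h0, hΔ']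
  rcases eq_or_lt_of_le hΔ.1 with hΔ1 | hΔ1
  · -- `Δ = -1`
    rw [← hΔ1, add_neg_cancel, zero_mul]
    exact lam_nonneg M _
  · have h := hR M hE h4 Δ 0 hΔ1 hΔ.2 le_rfl ψrΔ ψr0 hGSΔ hnnΔ hGS0 hnn0
    rw [add_zero, one_mul] at h
    exact h

/-- **PLAN A's diagonal closes the crux directly.**  If for every even `M ≥ 4` some family `Ψ` of real
non-negative normalised sector ground states has `u ↦ Λ(Ψ u)` differentiable on `(-1,0)` with the
LOG-SLOPE BOUND `(1+u)·Λ' ≤ Λ` there and continuous at `0` from the left, then `ChordXY` holds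
(`lamRatio_le_of_logSlope` + `chordXY_of_lamRatioAntitone`).  The hypothesis (H1 + H2 of the stub-critic's
PLAN A, diagonal only) is explicit; it is the open content of the line. [bookkeeping] -/
theorem chordXY_of_logSlope
    (hLS : ∀ (M : ℕ) [NeZero M], Even M → 4 ≤ M → ∃ (Ψ : ℝ → Config M → ℝ) (L' : ℝ → ℝ),
      (∀ u, IsGS M u (ofReal M (Ψ u))) ∧
      (∀ u ∈ Set.Ioo (-1:ℝ) 0, HasDerivAt (fun v => lam M (ofReal M (Ψ v))) (L' u) u) ∧
      (∀ u ∈ Set.Ioo (-1:ℝ) 0, (1 + u) * L' u ≤ lam M (ofReal M (Ψ u))) ∧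
      ContinuousWithinAt (fun v => lam M (ofReal M (Ψ v))) (Set.Iic 0) 0) :
    Summit.HubbardSuperconductivity.HubbardSuperconductivity.Theses.AnisotropyChord.ChordXY := by
  refine chordXY_of_lamRatioAntitone fun M _ hE h4 s t hs hst ht ψs ψt hGSs _ hGSt _ => ?_
  obtain ⟨Ψ, L', hΨ, hd, hls, hc0⟩ := hLS M hE h4
  exact lamRatio_le_of_logSlope M hE Ψ hΨ L' hd hls hc0 s t hs hst ht ψs ψt hGSs hGSt

/-- The step-local ratio inequality (every even `M ≥ 4`, every `a > -1`, some step `δ(M,a) > 0`) also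
gives `ChordXY` by name (`lamRatioAntitone_of_local` + `chordXY_of_lamRatioAntitone`). [bookkeeping] -/
theorem chordXY_of_localLamRatio
    (hL : ∀ (M : ℕ) [NeZero M], Even M → 4 ≤ M → ∀ a : ℝ, -1 < a → ∃ δ : ℝ, 0 < δ ∧
      ∀ (s t : ℝ), a ≤ s → s ≤ t → t ≤ 0 → t - s ≤ δ →
        ∀ (ψs ψt : Config M → ℝ), IsGS M s (ofReal M ψs) → (∀ σ, 0 ≤ ψs σ) →
          IsGS M t (ofReal M ψt) → (∀ σ, 0 ≤ ψt σ) →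
            (1 + s) * lam M (ofReal M ψt) ≤ (1 + t) * lam M (ofReal M ψs)) :
    Summit.HubbardSuperconductivity.HubbardSuperconductivity.Theses.AnisotropyChord.ChordXY :=
  chordXY_of_lamRatioAntitone fun M _ hE h4 => lamRatioAntitone_of_local M hE (hL M hE h4)

end Summit.HubbardSuperconductivity.HubbardSuperconductivity.Theorems.AnisotropyChord.DoobJohnsonChord

end
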